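import Summits.QuantumFields.BalabanUV.T4Continuum.Spine.NE1p.DressedSmallFieldSlotLettersWitnessEnd

/-!
# T⁴ programme, spine estimate NE1′ (node O3b/H2) — WITNESS W⟨next⟩ (follower of W58 «THE SLOT-LETTERS END FIRES ON THE TORUS»; OPEN OFFER
# O-g12a, typer R-T139, from leaf-06-g12's note N-ne1pleaf06g12-1): ON W58's DATUM THE ACTIVITY OF RECORD IS OPERATOR-BLIND — the
# Gaussian letters of record `N(o)`, `q(o)` are LIVE in the operator datum `o` (W58 PART 1 §3), but the factor activity
# `actOfLetters … (coreLettersOf … (AW D)) Z j o h = e^{V″(h)(Z,0)} − 1` does NOT depend on `o` wherever `Re(2 + ϑW·o) > 0` (so on the whole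
# operator ball): the complex Gaussian of record RENORMALISES at every `o` — Mathlib's complex Gaussian integral and the principal
# branch bookkeeping `e^{½ log c}·(2π∕c)^{1∕2} = √(2π)` in kernel

Cell `pub-balaban`, sub-cell `t4`, row NE1′ formalisation crew (`t4/formal/NE1p/LEAVES.md` row W⟨next⟩ — OPEN OFFER O-g12a of typer R-T139
«optionally a locating-witness row `actOfLetters_operator_blind` for anyone outside p1 — INFO-grade, not owed», banked from leaf-06-g12's
by-hand computation N-ne1pleaf06g12-1 (journal l.22740) and ERRATUM (l.22786); INTENT `CLAIMS.log` l.⟨this gen⟩), unit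
`b2b-balaban-t4-ne1p-formalise-leaf-04` (LEAF PROVER 04, gen 16 — W58's author lineage).  ADDITIVE — imports W58 PART 2
`Spine/NE1p/DressedSmallFieldSlotLettersWitnessEnd` ONLY (⇒ PART 1: the datum `AW D`, `ℓW`, `PW D`, `ϑW`, `rW`, the LIVE letters `N_ℓW` ∕
`q_ℓW`; PART 2: `readOut_core`, `chi_core`, `wJ_core`, `actOfLetters_zero_closed`, `termsW`, `wW`, `actSW`; W40's `instUniqueIdx`; row NE5's
`integral_w₁_mul_eq_sub`) — LANDED; THEOREMS ONLY (0 def, 0 `def … : Prop`, 0 cite, 0 sorry); nothing of PART 1∕2 restated — used BY NAME.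

WHAT.
* §20 **`letters_renormalise`** — THE PRINCIPAL-BRANCH IDENTITY: for `Re c > 0`, `(2π)^{−1∕2} · e^{½·log c} · (π ∕ (c∕2))^{1∕2} = 1` (Mathlib
  `Complex.cpow_def_of_ne_zero`, `Complex.log_ofReal_mul`, `Complex.log_inv` — `arg c ≠ π` because `Re c > 0` —, `Real.sqrt_eq_rpow`); i.e. the
  normalisation letter of record `N(o) = (2π)^{−1∕2}·e^{½ log(2 + ϑW·o)}` (PART 1 `N_ℓW`) times the complex Gaussian volume of the quadratic
  letter `q(o) = ½(2 + ϑW·o)·v²` (PART 1 `q_ℓW`; Mathlib `GaussianFourier.integral_cexp_neg_mul_sq_norm` on `E1`, `inner_core`) is EXACTLY `1`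
  at every `o` with `Re(2 + ϑW·o) > 0` — not only at the centre (PART 2 §4 did `o = 0`: `π^{−1∕2}·√π`).
* §21 **`actOfLetters_closed`** — `actOfLetters (PW D) ℂ … (coreLettersOf … (AW D)) Z j o h = e^{V″(h)(Z,0)} − 1` for EVERY `o` with
  `Re(2 + ϑW·o) > 0` (PART 2 §4's proof with §20 in place of the centre's `√π` cancellation; row NE5's `integral_w₁_mul_eq_sub` ONCE);
  **`actOfLetters_operator_blind`** — hence `= actOfLetters … Z j 0 h` on `‖o‖ < 2` (⊇ the operator ball `‖o − ctr.1‖ < R′ = 1` of W58's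
  ENDs); `actSW_operator_blind` — the summed slot activity likewise, so the function W66's JOINT (operator, source) holomorphy END
  `opSource_joint_fires_torus` speaks about is CONSTANT in its operator variable on `ball 0 (1∕2)` (an INFO for W66's readers, made kernel).
* §22 GENUINE — THE LETTERS ARE LIVE, THE CORE's VALUE IS NOT: `N_ℓW_one_ne_zero'` (`N 1 a ≠ N 0 a`: `(2π)^{−1∕2}√3 ≠ π^{−1∕2}`),
  `q_ℓW_one_ne_zero'` (`q 1 a v ≠ q 0 a v` whenever `v ≠ 0`), against `actOfLetters_operator_blind` at `o = 1` — leaf-06-g12's located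
  remark «liveness in `o` lives in W58's LETTERS, not in the core's value» as three kernel facts.

HONEST FRAMING (typer R-T139 wording ADOPTED: O-g12a is INFO-grade).  A DECIDED TOY ([folklore]; 0 sorry; 0 citations; no `def`): a
closed-form evaluation of OUR 1×1 complex Gaussian table's factor activity at every operator datum in the half-plane `Re(2 + ϑW·o) > 0`,
by Mathlib's complex Gaussian integral and principal-branch algebra; it says NOTHING about Bałaban's (2.14) densities, whose operator
dependence (through `C^{(k)}(Z₀,σ)`, `Γ_k`, the backgrounds) is NOT of this toy form — the blindness is a property of OUR datum's
normalisation OF RECORD (the substrate's `gaussN`∕`gaussQ` letters renormalise at each `o` by construction), located here so that readers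
of W58∕W66∕W73 know which variables of the crew's ENDs are exercised non-trivially on this datum (the SOURCE∕table variable: W73's
`slotLettersMuEnd_vanishes_iff`; NOT the operator variable); (B1b) by definition of the toy; (B3) untouched; 0 binders instantiated on
Bałaban's densities; no wall item; the NE1′ wall (wording v1.8, T4-DAG v48∕v49; kind v1.7) does NOT move; R-t4r2-Q2 NOT met thereby;
NE1′ ⇐ the named binders — NOT proved, NOT printed; spine PROVED 0∕9; count 9 unchanged.  Rung (B)+1 on ONE finite four-torus — NOT
infinite volume, NOT a mass gap, NOT OS on ℝ⁴, NOT Clay.  HONEST DEPENDENCY: continuum YM on T⁴ ⇐ BetaPertH ∧ nine spine estimates (0/9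
proved); BetaPertH ⇐ (D1) ∧ (D4) ∧ CAP+tail; G-an2-4 gates asym, D1 and NE2/3/4.
-/

noncomputable section

namespace Summit.QuantumFields.BalabanUV.T4Continuum.NE1p.DressedSmallFieldSlotLettersWitnessBlind

open Set Metric MeasureTheory Complex
open scoped BigOperators Matrix
open Literature.MathematicalPhysics.QuantumFieldTheory.Balaban1983to89
open Literature.MathematicalPhysics.QuantumFieldTheory.Balaban1983to89.TreeLengthTorus (TDom tsys)
open Summit.QuantumFields.BalabanUV.T4Continuum.B13HistMeasurable (MeasPotFrame B13HistM)
open Summit.QuantumFields.BalabanUV.T4Continuum.B13TermParamGaussianBi (BiCore)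
open Summit.QuantumFields.BalabanUV.T4Continuum.B13TermContours (lam₁ w₁ circ lamJ wJ radii integral_w₁_mul_eq_sub)
open Summit.QuantumFields.BalabanUV.T4Continuum.SubstrateTwoRunsDriven (DrivenRuns)
open Summit.QuantumFields.BalabanUV.T4Continuum.SubstrateActivities (CoreLetters coreOf actOfLetters actOfLetters_apply)
open Summit.QuantumFields.BalabanUV.T4Continuum.SubstrateGaussianLetters (gaussC)
open Summit.QuantumFields.BalabanUV.T4Continuum.SubstrateSlotsOfRecord (ActLetters coreLettersOf)
open Summit.QuantumFields.BalabanUV.T4Continuum.NE1p.DressedSmallFieldCoresWitness (E1 crd)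
open Summit.QuantumFields.BalabanUV.T4Continuum.NE1p.DressedSmallFieldTorusWitness (X₀)
open Summit.QuantumFields.BalabanUV.T4Continuum.NE1p.DressedSmallFieldSlotWitness (instUniqueIdx)
open Summit.QuantumFields.BalabanUV.T4Continuum.NE1p.DressedSmallFieldSlotLettersWitness
open Summit.QuantumFields.BalabanUV.T4Continuum.NE1p.DressedSmallFieldSlotLettersWitnessEnd

variable {G : Type} [GaugeGroup G] (D : DrivenRuns G)

/-! ## §20 The principal-branch identity: the normalisation letter of record times the complex Gaussian volume is `1` at every `o` -/

/-- **THE LETTERS RENORMALISE AT EVERY OPERATOR DATUM** (principal branch, `Re c > 0`):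
`(2π)^{−1∕2} · e^{½ log c} · (π∕(c∕2))^{1∕2} = 1` — `(π∕(c∕2))^{1∕2} = e^{½ log(2π·c⁻¹)}`, `log(2π·c⁻¹) = log(2π) − log c` since `arg c ≠ π`
(`Re c > 0`), and `e^{½ log(2π)} = √(2π)`. [folklore] -/
theorem letters_renormalise {c : ℂ} (hc : 0 < c.re) :
    (gaussC (Fin 1) : ℂ) * cexp (Complex.log c / 2) * ((Real.pi : ℂ) / (c / 2)) ^ ((1 : ℂ) / 2) = 1 := by
  have hc0 : c ≠ 0 := fun h => by rw [h, Complex.zero_re] at hc; exact lt_irrefl _ hc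
  have harg : c.arg ≠ Real.pi := fun h => by
    have h' := (Complex.arg_eq_pi_iff.1 h).1; linarith
  have h2π : (0 : ℝ) < 2 * Real.pi := Real.two_pi_pos
  have hne : ((2 * Real.pi : ℝ) : ℂ) * c⁻¹ ≠ 0 := mul_ne_zero (by exact_mod_cast h2π.ne') (inv_ne_zero hc0)
  have hquot : (Real.pi : ℂ) / (c / 2) = ((2 * Real.pi : ℝ) : ℂ) * c⁻¹ := by
    push_cast; field_simp
  rw [hquot, Complex.cpow_def_of_ne_zero hne, Complex.log_ofReal_mul h2π (inv_ne_zero hc0), Complex.log_inv c harg, mul_assoc,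
    ← Complex.exp_add, show Complex.log c / 2 + ((Real.log (2 * Real.pi) : ℝ) + -Complex.log c) * ((1 : ℂ) / 2) =
      ((Real.log (2 * Real.pi) * (1 / 2) : ℝ) : ℂ) by push_cast; ring, ← Complex.ofReal_exp, ← Real.rpow_def_of_pos h2π,
    ← Real.sqrt_eq_rpow]
  unfold gaussC
  rw [Fintype.card_fin, pow_one, Complex.ofReal_inv, inv_mul_cancel₀]
  exact_mod_cast (Real.sqrt_pos.2 h2π).ne'

/-- On E1 the norm IS the coordinate up to sign: `‖v‖² = (crd v)²` (as complex numbers). [folklore] -/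
theorem norm_sq_eq_crd_sq (v : E1) : ((‖v‖ : ℝ) : ℂ) ^ 2 = ((crd v : ℝ) : ℂ) ^ 2 := by
  rw [← Complex.ofReal_pow, ← Complex.ofReal_pow, EuclideanSpace.norm_eq, Fin.sum_univ_one, Real.sq_sqrt (sq_nonneg _),
    Real.norm_eq_abs, sq_abs]
  rfl

section Core
variable (Z : D.carriers.Dom) (j : Unit)

/-- **THE FLUCTUATION INTEGRAL AT EVERY OPERATOR DATUM** (Mathlib's complex Gaussian `GaussianFourier.integral_cexp_neg_mul_sq_norm` on
`E1` with parameter `b = (2 + ϑW·o)∕2`, `Re b > 0`): `∫ chi·e^{x}·e^{−q(o,p,v)} dv = e^{x}·(π∕((2 + ϑW·o)∕2))^{1∕2}`. [folklore] -/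
theorem inner_core {o : ℂ} (ho : 0 < (2 + (ϑW : ℂ) * o).re) (x : ℂ) (p : (PEmpty.{1} ⊕ Unit) → ℝ × ℝ) :
    ∫ v : E1, (coreOf (PW D) ℂ (𝒵W D) (domW D) (JcW D) (VW D) (ℓW D) Z j).chi v * cexp x *
        cexp (-(coreOf (PW D) ℂ (𝒵W D) (domW D) (JcW D) (VW D) (ℓW D) Z j).q o p v) =
      cexp x * ((Real.pi : ℂ) / ((2 + (ϑW : ℂ) * o) / 2)) ^ ((1 : ℂ) / 2) := by
  simp_rw [chi_core, one_mul]
  have hq : ∀ v : E1, cexp (-(coreOf (PW D) ℂ (𝒵W D) (domW D) (JcW D) (VW D) (ℓW D) Z j).q o p v) =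
      cexp (-((2 + (ϑW : ℂ) * o) / 2) * (‖v‖ : ℂ) ^ 2) := fun v => by
    congr 1
    have h := (q_ℓW D) Z j o p v
    rw [show (coreOf (PW D) ℂ (𝒵W D) (domW D) (JcW D) (VW D) (ℓW D) Z j).q o p v = ((ℓW D) Z j).q o p v from rfl, h, norm_sq_eq_crd_sq]
    ring
  simp_rw [hq]
  rw [integral_const_mul]
  congr 1
  have hb : 0 < ((2 + (ϑW : ℂ) * o) / 2).re := by
    rw [show (2 + (ϑW : ℂ) * o) / 2 = (2 + (ϑW : ℂ) * o) * ((1 / 2 : ℝ) : ℂ) by push_cast; ring, Complex.mul_re,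
      Complex.ofReal_re, Complex.ofReal_im, mul_zero, sub_zero]
    positivity
  rw [GaussianFourier.integral_cexp_neg_mul_sq_norm hb, finrank_euclideanSpace, Fintype.card_fin, Nat.cast_one]

/-- **THE ACTIVITY OF RECORD IN CLOSED FORM AT EVERY OPERATOR DATUM** [decided toy]: for `Re(2 + ϑW·o) > 0`,
`actOfLetters (coreLettersOf (AW D)) Z j o h = e^{V″(h)(Z,0)} − 1` — PART 2 §4's computation with the centre's cancellation `π^{−1∕2}·√π = 1`
replaced by §20's principal-branch identity at `c = 2 + ϑW·o`; the one-index `Measure.pi` collapses to `lam₁` (`measurePreserving_funUnique`),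
and row NE5's `integral_w₁_mul_eq_sub` (Cauchy + FTC) evaluates the contour integral at the entire `F τ := e^{τ·V″(h)(Z,0)}` ONCE. [folklore] -/
theorem actOfLetters_closed {o : ℂ} (ho : 0 < (2 + (ϑW : ℂ) * o).re) (h : B13HistM (PW D)) :
    actOfLetters (PW D) ℂ (𝒵W D) (domW D) (JcW D) (VW D) (ℓW D) Z j o h = cexp ((PW D).VppM h Z (fun _ => (0 : ℝ))) - 1 := by
  letI := instUniqueIdx
  rw [actOfLetters_apply]
  set c : ℂ := (PW D).VppM h Z (fun _ => (0 : ℝ)) with hc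
  unfold BiCore.termAt
  simp_rw [readOut_core, inner_core D Z j ho]
  have hN : ∀ p, (coreOf (PW D) ℂ (𝒵W D) (domW D) (JcW D) (VW D) (ℓW D) Z j).N o p =
      (gaussC (Fin 1) : ℂ) * cexp (Complex.log (2 + (ϑW : ℂ) * o) / 2) := fun p => (N_ℓW D) Z j o p
  simp_rw [hN]
  show ∫ p, wJ (radii (Jc := PEmpty.{1}) (1 : ℝ) (fun _ : Unit => rW)) p *
      ((gaussC (Fin 1) : ℂ) * cexp (Complex.log (2 + (ϑW : ℂ) * o) / 2)) *
      (cexp (circ rW (p (Sum.inr ())).2 * c) * ((Real.pi : ℂ) / ((2 + (ϑW : ℂ) * o) / 2)) ^ ((1 : ℂ) / 2))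
      ∂(lamJ (PEmpty.{1} ⊕ Unit)) = _
  have hren := letters_renormalise ho
  have hsimp : ∀ p : (PEmpty.{1} ⊕ Unit) → ℝ × ℝ, wJ (radii (Jc := PEmpty.{1}) (1 : ℝ) (fun _ : Unit => rW)) p *
      ((gaussC (Fin 1) : ℂ) * cexp (Complex.log (2 + (ϑW : ℂ) * o) / 2)) *
      (cexp (circ rW (p (Sum.inr ())).2 * c) * ((Real.pi : ℂ) / ((2 + (ϑW : ℂ) * o) / 2)) ^ ((1 : ℂ) / 2)) =
      w₁ rW (p (Sum.inr ())) * cexp (circ rW (p (Sum.inr ())).2 * c) := fun p => by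
    rw [wJ_core]
    calc w₁ rW (p (Sum.inr ())) * ((gaussC (Fin 1) : ℂ) * cexp (Complex.log (2 + (ϑW : ℂ) * o) / 2)) *
          (cexp (circ rW (p (Sum.inr ())).2 * c) * ((Real.pi : ℂ) / ((2 + (ϑW : ℂ) * o) / 2)) ^ ((1 : ℂ) / 2))
        = w₁ rW (p (Sum.inr ())) * cexp (circ rW (p (Sum.inr ())).2 * c) *
          ((gaussC (Fin 1) : ℂ) * cexp (Complex.log (2 + (ϑW : ℂ) * o) / 2) * ((Real.pi : ℂ) / ((2 + (ϑW : ℂ) * o) / 2)) ^ ((1 : ℂ) / 2)) := by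
          ring
      _ = w₁ rW (p (Sum.inr ())) * cexp (circ rW (p (Sum.inr ())).2 * c) := by rw [hren, mul_one]
  simp_rw [hsimp]
  have hmp := measurePreserving_funUnique lam₁ (PEmpty.{1} ⊕ Unit)
  have key : ∫ p, w₁ rW (p (Sum.inr ())) * cexp (circ rW (p (Sum.inr ())).2 * c) ∂(lamJ (PEmpty.{1} ⊕ Unit)) =
      ∫ y, w₁ rW y * cexp (circ rW y.2 * c) ∂lam₁ :=
    hmp.integral_comp' (fun y : ℝ × ℝ => w₁ rW y * cexp (circ rW y.2 * c))
  rw [key]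
  have hF : DifferentiableOn ℂ (fun τ : ℂ => cexp (τ * c)) univ := by
    apply Differentiable.differentiableOn; fun_prop
  rw [integral_w₁_mul_eq_sub (r := rW) one_lt_rW isOpen_univ (subset_univ _) hF]
  simp only [one_mul, zero_mul, Complex.exp_zero]

/-- On the disc `‖o‖ < 2` the quadratic letter's parameter has positive real part: `Re(2 + ϑW·o) > 0` (`ϑW = 1`). [folklore] -/
theorem re_pos_of_norm_lt_two {o : ℂ} (ho : ‖o‖ < 2) : 0 < (2 + (ϑW : ℂ) * o).re := by
  rw [ϑW, Complex.ofReal_one, one_mul, Complex.add_re]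
  have h := (abs_le.1 (Complex.abs_re_le_norm o)).1
  have h2 : (2 : ℂ).re = 2 := by norm_num
  rw [h2]
  linarith

/-- **THE ACTIVITY OF RECORD IS OPERATOR-BLIND ON THE DISC `‖o‖ < 2`** (⊇ the operator ball `‖o − ctr.1‖ < R′ = 1` of W58's ENDs)
[decided toy]: `actOfLetters … Z j o h = actOfLetters … Z j 0 h`. [folklore] -/
theorem actOfLetters_operator_blind {o : ℂ} (ho : ‖o‖ < 2) (h : B13HistM (PW D)) :
    actOfLetters (PW D) ℂ (𝒵W D) (domW D) (JcW D) (VW D) (ℓW D) Z j o h =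
      actOfLetters (PW D) ℂ (𝒵W D) (domW D) (JcW D) (VW D) (ℓW D) Z j 0 h := by
  rw [actOfLetters_closed D Z j (re_pos_of_norm_lt_two ho), actOfLetters_zero_closed]

end Core

section Torus
variable (N : ℕ) [NeZero N]

/-- **THE SUMMED SLOT ACTIVITY IS OPERATOR-BLIND**: the function of `(o, s)` that W66's JOINT holomorphy END `opSource_joint_fires_torus`
speaks about is CONSTANT in `o` on `‖o‖ < 2` — `Σ_{p ∈ termsW Z} actOfLetters … p.1 p.2 o (0 + s • wW) = Σ … 0 (0 + s • wW)`. [folklore] -/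
theorem actSum_operator_blind {o : ℂ} (ho : ‖o‖ < 2) (s : ℂ) (Z : (tsys 4 N).Dom) :
    ∑ p ∈ (termsW D) N Z, actOfLetters (PW D) ℂ (𝒵W D) (domW D) (JcW D) (VW D) (ℓW D) p.1 p.2 o ((0 : B13HistM (PW D)) + s • (wW D)) =
      ∑ p ∈ (termsW D) N Z, actOfLetters (PW D) ℂ (𝒵W D) (domW D) (JcW D) (VW D) (ℓW D) p.1 p.2 (0 : ℂ) ((0 : B13HistM (PW D)) + s • (wW D)) :=
  Finset.sum_congr rfl fun p _ => actOfLetters_operator_blind D p.1 p.2 ho _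

end Torus

/-! ## §22 GENUINE — THE LETTERS ARE LIVE IN `o`, THE CORE's VALUE IS NOT -/

section Live
variable (Z : D.carriers.Dom) (j : Unit) (a : (PEmpty.{1} ⊕ Unit) → ℝ × ℝ)

/-- The normalisation letter AT `o = 1`: `N 1 a = (2π)^{−1∕2}·√3` (`e^{½ log 3} = √3`). [folklore] -/
theorem N_ℓW_one : ((ℓW D) Z j).N 1 a = ((gaussC (Fin 1) * Real.sqrt 3 : ℝ) : ℂ) := by
  rw [N_ℓW, ϑW, Complex.ofReal_one, one_mul, show (2 : ℂ) + 1 = ((3 : ℝ) : ℂ) by norm_num,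
    ← Complex.ofReal_log (by norm_num : (0 : ℝ) ≤ 3), show ((Real.log 3 : ℝ) : ℂ) / 2 = ((Real.log 3 * (1 / 2) : ℝ) : ℂ) by push_cast; ring,
    ← Complex.ofReal_exp, ← Real.rpow_def_of_pos (by norm_num : (0 : ℝ) < 3), ← Real.sqrt_eq_rpow, Complex.ofReal_mul]

/-- **THE NORMALISATION LETTER IS LIVE**: `N 1 a ≠ N 0 a` (`(2π)^{−1∕2}·√3 ≠ π^{−1∕2} = (2π)^{−1∕2}·√2`). [folklore] -/
theorem N_ℓW_live : ((ℓW D) Z j).N 1 a ≠ ((ℓW D) Z j).N 0 a := by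
  rw [N_ℓW_one, N_ℓW_zero, Ne, Complex.ofReal_inj]
  intro h
  have hg : gaussC (Fin 1) = (Real.sqrt 2)⁻¹ * (Real.sqrt Real.pi)⁻¹ := by
    unfold gaussC; rw [Fintype.card_fin, pow_one, Real.sqrt_mul' _ Real.pi_pos.le, mul_inv]
  rw [hg] at h
  have hπ : 0 < Real.sqrt Real.pi := Real.sqrt_pos.2 Real.pi_pos
  have h2 : 0 < Real.sqrt 2 := Real.sqrt_pos.2 two_pos
  have h3 : Real.sqrt 3 = Real.sqrt 2 := by
    field_simp at h
    linarith
  have := congrArg (fun x => x ^ 2) h3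
  simp only [Real.sq_sqrt (by norm_num : (0:ℝ) ≤ 3), Real.sq_sqrt (by norm_num : (0:ℝ) ≤ 2)] at this
  norm_num at this

/-- **THE QUADRATIC LETTER IS LIVE**: `q 1 a v ≠ q 0 a v` whenever the fluctuation variable is non-zero (`3∕2·v² ≠ v²`). [folklore] -/
theorem q_ℓW_live {v : E1} (hv : crd v ≠ 0) : ((ℓW D) Z j).q 1 a v ≠ ((ℓW D) Z j).q 0 a v := by
  rw [q_ℓW, q_ℓW, ϑW, Complex.ofReal_one, one_mul, mul_zero, add_zero]
  intro h
  have hv2 : ((crd v : ℝ) : ℂ) ^ 2 ≠ 0 := pow_ne_zero 2 (Complex.ofReal_ne_zero.2 hv)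
  have h' : ((1 / 2 : ℂ) * (2 + 1) - (1 / 2) * 2) * ((crd v : ℝ) : ℂ) ^ 2 = 0 := by
    rw [sub_mul]; rw [mul_assoc, mul_assoc] at *; rw [h, sub_self]
  rcases mul_eq_zero.1 h' with h1 | h1
  · norm_num at h1
  · exact hv2 h1

/-- **… YET THE CORE's VALUE AT `o = 1` IS ITS VALUE AT THE CENTRE** (`actOfLetters_operator_blind` at `‖1‖ < 2`): liveness in `o` lives
in W58's LETTERS, not in the activity — leaf-06-g12's located remark (N-ne1pleaf06g12-1 ∕ ERRATUM) in kernel. [folklore] -/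
theorem actOfLetters_one_eq_zero (h : B13HistM (PW D)) :
    actOfLetters (PW D) ℂ (𝒵W D) (domW D) (JcW D) (VW D) (ℓW D) Z j 1 h =
      actOfLetters (PW D) ℂ (𝒵W D) (domW D) (JcW D) (VW D) (ℓW D) Z j 0 h :=
  actOfLetters_operator_blind D Z j (by rw [norm_one]; norm_num) h

end Live

end Summit.QuantumFields.BalabanUV.T4Continuum.NE1p.DressedSmallFieldSlotLettersWitnessBlind
end
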